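import Mathlib.Analysis.SpecialFunctions.Pow.Deriv
import Mathlib.Analysis.SpecialFunctions.Pow.Continuity
import Mathlib.Analysis.Calculus.ParametricIntegral
import Mathlib.MeasureTheory.Integral.DominatedConvergence
import Mathlib.MeasureTheory.Function.SpecialFunctions.Basic
import Mathlib.Probability.Moments.ComplexMGF
import HarnessLib

/-!
# Complex power moments `τ ↦ ∫ t^τ dν(t)` of a finite measure on `[0, 1]`

For a finite positive Borel measure `ν` on `ℝ` carried by `[0, 1]`, the **power moment function**
`M_ν(τ) = ∫ t^τ dν(t)` (`t^τ = e^{τ log t}`, Mathlib's `Complex.cpow`, with `0^τ = 0` for `τ ≠ 0`)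
is the Laplace transform `∫ e^{-τE} dρ(E)` of the image of `ν` under `t = e^{-E}`; it is the
scalar form of a self-adjoint contraction semigroup `e^{-τH}`, `H ≥ 0`, written through the
spectral measure of `e^{-H}` (Osterwalder–Schrader I (1973), §4.1, p. 92: "`T^τ`, `τ = t + is`, is a
holomorphic semigroup for `Re τ > 0`, uniformly bounded and strongly continuous for `Re τ ≥ 0`";
Reed–Simon I §VII.2 for the measures). Mathlib has the closely related `ProbabilityTheory.complexMGF X ν z = ∫ e^{z X} dν`; with
`X = Real.log` it agrees with `M_ν` as soon as `ν` has **no atom at `t = 0`**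
(`cpowMoment_eq_complexMGF_log`), but differs there in general (`e^{z log 0} = 1` in Mathlib's
conventions, whereas `0^z = 0` for `z ≠ 0`, which is the value dictated by `e^{-zH}` on
`ker e^{-H}` — and the absence of that atom is something to be *proved* for spectral measures,
`tendsto_integral_rpow_nhdsGT_zero` below, not assumed). We therefore keep the `cpow` form and
give direct proofs (which cover an atom at `0`) of the three analytic properties behind OS's
sentence, for measures:

* `norm_cpowMoment_le` — `|M_ν(τ)| ≤ ν(ℝ)` for `Re τ ≥ 0` (`|t^τ| ≤ 1` on `[0, 1]`);
* `differentiableAt_cpowMoment` / `differentiableOn_cpowMoment` — `M_ν` is holomorphic on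
  `{Re τ > 0}` (differentiation under the integral sign, the derivative `t^τ log t` being bounded
  by `1/a` when `Re τ > a > 0`);
* `continuousOn_cpowMoment` — if `ν{0} = 0`, `M_ν` is continuous on the closed half-plane
  `{Re τ ≥ 0}` (dominated convergence; the atom at `t = 0` is excluded because `τ ↦ 0^τ` jumps at
  `τ = 0`);
* `cpowMoment_ofReal` — on the positive real axis `M_ν(s) = ∫ t^s dν(t)` (real powers), and
  `tendsto_integral_rpow_nhdsGT_zero` — `∫ t^s dν → ν((0, ∞))` as `s → 0⁺`, the criterion by
  which strong continuity of a semigroup at `0` excludes the atom at `t = 0`.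

## References
* K. Osterwalder, R. Schrader, Axioms for Euclidean Green's functions, CMP 31 (1973), §4.1 p. 92.
* M. Reed, B. Simon, Methods of Modern Mathematical Physics I (rev. ed. 1980), §VII.2; II (1975),
  §X.8 (holomorphic semigroups), for the classical statements.
-/

noncomputable section

open MeasureTheory Set
open _root_.Filter _root_.Topology _root_.Complex

namespace Literature.Analysis.OperatorTheory

/-! ## Pointwise estimates for `t ↦ t^τ` on `[0, 1]` -/

/-- `|t^τ| ≤ 1` for `t ∈ [0, 1]` and `Re τ ≥ 0` (for `t > 0`, `|t^τ| = t^{Re τ}`; `0^τ ∈ {0, 1}`). [folklore] -/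
theorem norm_ofReal_cpow_le_one {t : ℝ} (ht : t ∈ Icc (0 : ℝ) 1) {τ : ℂ} (hτ : 0 ≤ τ.re) :
    ‖(t : ℂ) ^ τ‖ ≤ 1 := by
  refine (norm_cpow_le _ _).trans ?_
  rw [arg_ofReal_of_nonneg ht.1, zero_mul, Real.exp_zero, div_one, Complex.norm_of_nonneg ht.1]
  exact Real.rpow_le_one ht.1 ht.2 hτ

/-- The derivative bound: for `t ∈ [0, 1]` and `Re τ ≥ a > 0`, `|t^τ log t| ≤ 1/a`
(`t^{Re τ} |log t| ≤ t^a log(1/t) ≤ 1/a`). [folklore] -/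
theorem norm_ofReal_cpow_mul_log_le {t : ℝ} (ht : t ∈ Icc (0 : ℝ) 1) {τ : ℂ} {a : ℝ} (ha : 0 < a)
    (hτ : a ≤ τ.re) : ‖(t : ℂ) ^ τ * Complex.log t‖ ≤ 1 / a := by
  rcases ht.1.eq_or_lt with rfl | ht0
  · simp only [ofReal_zero, Complex.log_zero, mul_zero, norm_zero]
    positivity
  · rw [norm_mul, norm_cpow_eq_rpow_re_of_pos ht0, ← Complex.ofReal_log ht0.le, Complex.norm_real,
      Real.norm_eq_abs]
    have hlog : Real.log t ≤ 0 := Real.log_nonpos ht0.le ht.2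
    rw [abs_of_nonpos hlog]
    -- `-log t = log (1/t) ≤ (1/t)^a / a`, and `t^{Re τ} ≤ t^a`
    have h1 : -Real.log t ≤ t⁻¹ ^ a / a := by
      rw [← Real.log_inv]
      exact Real.log_le_rpow_div (inv_pos.2 ht0).le ha
    have h2 : t ^ τ.re ≤ t ^ a := Real.rpow_le_rpow_of_exponent_ge ht0 ht.2 hτ
    have h3 : 0 ≤ t ^ τ.re := Real.rpow_nonneg ht0.le _
    calc t ^ τ.re * -Real.log t ≤ t ^ a * (t⁻¹ ^ a / a) :=
          mul_le_mul h2 h1 (neg_nonneg.2 hlog) (Real.rpow_nonneg ht0.le _)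
      _ = 1 / a := by
          rw [Real.inv_rpow ht0.le, mul_div_assoc', mul_inv_cancel₀ (Real.rpow_pos_of_pos ht0 a).ne']

/-- `τ ↦ t^τ` (derivative in the EXPONENT) has derivative `t^τ log t` at every `τ ≠ 0` (and at
`τ = 0` if `t ≠ 0`); Mathlib's `hasStrictDerivAt_const_cpow` specialised to a real base. [folklore] -/
theorem hasDerivAt_ofReal_const_cpow (t : ℝ) {τ : ℂ} (h : (t : ℂ) ≠ 0 ∨ τ ≠ 0) :
    HasDerivAt (fun τ : ℂ => (t : ℂ) ^ τ) ((t : ℂ) ^ τ * Complex.log t) τ :=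
  (hasStrictDerivAt_const_cpow h).hasDerivAt

/-! ## The power moment function of a finite measure on `[0, 1]` -/

variable (ν : Measure ℝ) [IsFiniteMeasure ν]

/-- The **complex power moment** `M_ν(τ) = ∫ t^τ dν(t)` of a finite measure `ν` on `ℝ`
(intended for `ν` carried by `[0, 1]`; Bochner integral, `Complex.cpow`). In the variable
`t = e^{-E}` this is the Laplace transform `∫ e^{-τE} dρ(E)` of Osterwalder–Schrader I (1973),
§4.1 p. 92 / Reed–Simon I §VII.2. [folklore] -/
def cpowMoment (τ : ℂ) : ℂ := ∫ t, (t : ℂ) ^ τ ∂ν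

/-- `t ↦ t^τ` is measurable. [folklore] -/
theorem measurable_ofReal_cpow_const (τ : ℂ) : Measurable fun t : ℝ => (t : ℂ) ^ τ :=
  measurable_ofReal.pow_const τ

variable {ν}

/-- `t ↦ t^τ` is integrable against a finite measure carried by `[0, 1]` when `Re τ ≥ 0`. [folklore] -/
theorem integrable_ofReal_cpow (hν : ∀ᵐ t ∂ν, t ∈ Icc (0 : ℝ) 1) {τ : ℂ} (hτ : 0 ≤ τ.re) :
    Integrable (fun t : ℝ => (t : ℂ) ^ τ) ν :=
  Integrable.of_bound (measurable_ofReal_cpow_const τ).aestronglyMeasurable 1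
    (hν.mono fun _ ht => norm_ofReal_cpow_le_one ht hτ)

/-- **Uniform bound** `|M_ν(τ)| ≤ ν(ℝ)` on the closed right half-plane. [folklore] -/
theorem norm_cpowMoment_le (hν : ∀ᵐ t ∂ν, t ∈ Icc (0 : ℝ) 1) {τ : ℂ} (hτ : 0 ≤ τ.re) :
    ‖cpowMoment ν τ‖ ≤ ν.real univ := by
  unfold cpowMoment
  have h := norm_integral_le_of_norm_le_const (C := 1) (hν.mono fun _ ht => norm_ofReal_cpow_le_one ht hτ)
  simpa using h

omit [IsFiniteMeasure ν] in
/-- **On the real axis the power moment is the real power integral**: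
`M_ν(s) = ∫ t^s dν(t)` for real `s`, `ν` carried by `[0, ∞)`. [folklore] -/
theorem cpowMoment_ofReal (hν : ∀ᵐ t ∂ν, (0 : ℝ) ≤ t) (s : ℝ) :
    cpowMoment ν s = ((∫ t, t ^ s ∂ν : ℝ) : ℂ) := by
  unfold cpowMoment
  rw [← integral_complex_ofReal]
  refine integral_congr_ae (hν.mono fun _ ht => ?_)
  exact (ofReal_cpow ht s).symm

omit [IsFiniteMeasure ν] in
/-- **Link with Mathlib's complex moment generating function**: if `ν` is carried by `(0, ∞)`
(no atom at `0`), then `M_ν = complexMGF log ν`, i.e. `∫ t^z dν = ∫ e^{z log t} dν`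
(`t^z = e^{z log t}` for `t > 0`). [folklore] -/
theorem cpowMoment_eq_complexMGF_log (hpos : ∀ᵐ t ∂ν, (0 : ℝ) < t) :
    cpowMoment ν = ProbabilityTheory.complexMGF Real.log ν := by
  funext z
  unfold cpowMoment ProbabilityTheory.complexMGF
  refine integral_congr_ae (hpos.mono fun t ht => ?_)
  simp only
  rw [cpow_def_of_ne_zero (ofReal_ne_zero.2 ht.ne'), ← ofReal_log ht.le, mul_comm]

omit [IsFiniteMeasure ν] in
/-- The same link under the hypotheses used in this file: carried by `[0, 1]` and no atom at
`0`. [folklore] -/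
theorem cpowMoment_eq_complexMGF_log' (hν : ∀ᵐ t ∂ν, t ∈ Icc (0 : ℝ) 1) (h0 : ν {0} = 0) :
    cpowMoment ν = ProbabilityTheory.complexMGF Real.log ν := by
  refine cpowMoment_eq_complexMGF_log ?_
  have h1 : ∀ᵐ t ∂ν, t ≠ 0 := by
    rw [ae_iff]
    simpa using h0
  filter_upwards [hν, h1] with t ht ht0 using lt_of_le_of_ne ht.1 (Ne.symm ht0)

/-- **Holomorphy**: `M_ν` is complex differentiable at every `τ` with `Re τ > 0`, with derivative
`∫ t^τ log t dν(t)` (differentiation under the integral sign; the derivative is bounded by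
`2 / Re τ` on the disc of radius `Re τ / 2`). This is the scalar content of "`T^τ` is a holomorphic
semigroup for `Re τ > 0`" (Osterwalder–Schrader I (1973), §4.1 p. 92, via the spectral theorem;
here for measures, by `hasDerivAt_integral_of_dominated_loc_of_deriv_le`). [folklore] -/
theorem hasDerivAt_cpowMoment (hν : ∀ᵐ t ∂ν, t ∈ Icc (0 : ℝ) 1) {τ₀ : ℂ} (hτ₀ : 0 < τ₀.re) :
    HasDerivAt (cpowMoment ν) (∫ t, (t : ℂ) ^ τ₀ * Complex.log t ∂ν) τ₀ := by
  set a : ℝ := τ₀.re / 2 with ha_def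
  have ha : 0 < a := by positivity
  -- the disc of radius `a` around `τ₀` stays in `Re τ > a`
  have hball : ∀ τ ∈ Metric.ball τ₀ a, a ≤ τ.re := fun τ hτ => by
    have h1 : |τ.re - τ₀.re| < a := by
      have := abs_re_le_norm (τ - τ₀)
      rw [sub_re] at this
      exact this.trans_lt (mem_ball_iff_norm.1 hτ)
    have := (abs_lt.1 h1).1
    linarith
  have hball0 : ∀ τ ∈ Metric.ball τ₀ a, τ ≠ 0 := fun τ hτ h0 => by
    have := hball τ hτ; rw [h0, zero_re] at this; linarith
  have key := hasDerivAt_integral_of_dominated_loc_of_deriv_le (μ := ν) (x₀ := τ₀)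
    (F := fun τ (t : ℝ) => (t : ℂ) ^ τ) (F' := fun τ (t : ℝ) => (t : ℂ) ^ τ * Complex.log t)
    (bound := fun _ => 1 / a) (Metric.ball_mem_nhds τ₀ ha)
    (Eventually.of_forall fun τ => (measurable_ofReal_cpow_const τ).aestronglyMeasurable)
    (integrable_ofReal_cpow hν hτ₀.le)
    (((measurable_ofReal_cpow_const τ₀).mul
      (Complex.measurable_log.comp measurable_ofReal)).aestronglyMeasurable)
    (hν.mono fun _ ht τ hτ => norm_ofReal_cpow_mul_log_le ht ha (hball τ hτ))
    (integrable_const _)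
    (Eventually.of_forall fun t τ hτ => hasDerivAt_ofReal_const_cpow t (Or.inr (hball0 τ hτ)))
  exact key.2

/-- `M_ν` is complex differentiable at every point of the open right half-plane. [folklore] -/
theorem differentiableAt_cpowMoment (hν : ∀ᵐ t ∂ν, t ∈ Icc (0 : ℝ) 1) {τ : ℂ} (hτ : 0 < τ.re) :
    DifferentiableAt ℂ (cpowMoment ν) τ :=
  (hasDerivAt_cpowMoment hν hτ).differentiableAt

/-- **`M_ν` is holomorphic on `{Re τ > 0}`.** [folklore] -/
theorem differentiableOn_cpowMoment (hν : ∀ᵐ t ∂ν, t ∈ Icc (0 : ℝ) 1) :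
    DifferentiableOn ℂ (cpowMoment ν) {τ | 0 < τ.re} := fun _ hτ =>
  (differentiableAt_cpowMoment hν hτ).differentiableWithinAt

/-- **Continuity up to the imaginary axis**: if `ν` has no atom at `0`, `M_ν` is continuous on the
closed half-plane `{Re τ ≥ 0}` (dominated convergence; for `t > 0` the map `τ ↦ t^τ` is entire).
This is the scalar content of "strongly continuous for `Re τ ≥ 0`" (Osterwalder–Schrader I (1973),
§4.1 p. 92, for the semigroup; here for measures). [folklore] -/
theorem continuousOn_cpowMoment (hν : ∀ᵐ t ∂ν, t ∈ Icc (0 : ℝ) 1) (h0 : ν {0} = 0) :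
    ContinuousOn (cpowMoment ν) {τ | 0 ≤ τ.re} := by
  have hpos : ∀ᵐ t ∂ν, 0 < t := by
    have h1 : ∀ᵐ t ∂ν, t ≠ 0 := by
      rw [ae_iff]
      simpa using h0
    filter_upwards [hν, h1] with t ht ht0 using lt_of_le_of_ne ht.1 (Ne.symm ht0)
  refine continuousOn_of_dominated (bound := fun _ => 1)
    (fun τ _ => (measurable_ofReal_cpow_const τ).aestronglyMeasurable)
    (fun τ hτ => hν.mono fun _ ht => norm_ofReal_cpow_le_one ht hτ) (integrable_const _) ?_
  filter_upwards [hpos] with t ht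
  exact fun τ _ => (continuousAt_const_cpow (ofReal_ne_zero.2 ht.ne')).continuousWithinAt

/-- **The atom at `0` and the limit `s → 0⁺`**: `∫ t^s dν(t) → ν((0, ∞))` as `s ↓ 0` (real powers;
`t^s → 1` for `t > 0` while `0^s = 0` for `s > 0`). For the spectral measure of `e^{-H}` the left
side is `⟪ψ, e^{-sH}ψ⟫ → ‖ψ‖² = ν(ℝ)`, which forces `ν{0} = 0`. [folklore] -/
theorem tendsto_integral_rpow_nhdsGT_zero (hν : ∀ᵐ t ∂ν, t ∈ Icc (0 : ℝ) 1) :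
    Tendsto (fun s : ℝ => ∫ t, t ^ s ∂ν) (𝓝[>] 0) (𝓝 (ν.real (Ioi 0))) := by
  have hlim : ∀ t : ℝ, t ∈ Icc (0 : ℝ) 1 →
      Tendsto (fun s : ℝ => t ^ s) (𝓝[>] 0) (𝓝 ((Ioi (0 : ℝ)).indicator 1 t)) := by
    intro t ht
    rcases ht.1.eq_or_lt with rfl | ht0
    · rw [indicator_of_notMem (by simp)]
      refine tendsto_const_nhds.congr' ?_
      filter_upwards [self_mem_nhdsWithin] with s hs
      exact (Real.zero_rpow (ne_of_gt hs)).symm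
    · rw [indicator_of_mem (show t ∈ Ioi (0 : ℝ) from ht0), Pi.one_apply]
      have h := ((Real.continuousAt_const_rpow (b := 0) ht0.ne').tendsto).mono_left
        (nhdsWithin_le_nhds (s := Ioi (0 : ℝ)))
      simpa [Real.rpow_zero] using h
  have h := tendsto_integral_filter_of_dominated_convergence (μ := ν) (l := 𝓝[>] (0 : ℝ))
    (F := fun (s : ℝ) (t : ℝ) => t ^ s) (f := (Ioi (0 : ℝ)).indicator 1) (fun _ => (1 : ℝ))
    (Eventually.of_forall fun s => (measurable_id.pow_const s).aestronglyMeasurable) ?_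
    (integrable_const _) ?_
  · simpa [integral_indicator_one measurableSet_Ioi] using h
  · filter_upwards [self_mem_nhdsWithin] with s hs
    exact hν.mono fun _ ht => by
      rw [Real.norm_eq_abs, abs_of_nonneg (Real.rpow_nonneg ht.1 s)]
      exact Real.rpow_le_one ht.1 ht.2 hs.le
  · exact hν.mono fun t ht => hlim t ht

end Literature.Analysis.OperatorTheory
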